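import Summits.QuantumFields.BalabanUV.Beta.FP.GhostMixTwoLeg
import Summits.QuantumFields.BalabanUV.Beta.FP.FineSplitJunctionMajorant

/-!
# `Beta/FP/GhostMixCubicTwoLeg` — road «FP» (binder row D1), row KER-γ (α2) sub-row **α2-c** «GHOST», THE (MIX-3) GHOST WORD IN THE JUNCTION's TWO-LEG
# MAJORANT CURRENCY (ruling R-FP-36 (b) «the cubic twin's shape»; owner l.28436: «(hk) product shape OR (Mκ) windowed-majorant shape, per piece»): per `(c, e)`
# entry a POINTWISE majorant `κ` + its windowed majorant letter (Mκ) of `FineSplitJunctionMajorant.coarse_secondMoment_abs_of_majorant_twoLeg` ∕ `rem_of_majorant`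
# (F′) — the cubic profile has a `(‖·‖∞+1)⁻⁸` tail with no exponential at the window rate, so the product shape of F is not available

HONEST DEPENDENCY (page 1, mandatory): continuum YM on T⁴ ⇐ BetaPertH ∧ nine spine estimates (0/9 proved); BetaPertH ⇐ (D1) ∧ (D4) ∧
CAP+tail; G-an2-4 gates asym, D1 and NE2/3/4.  HONEST FRAMING (cell contract, verbatim): «discharging `BetaPertH` makes Bałaban's UV
stability UNCONDITIONAL — a real constructive-QFT result; it is NOT the continuum limit and NOT the Clay problem.»  THIS MODULE is [folklore] lattice
bookkeeping on `ℤ⁴` BY NAME over `MixLoopPowerCountingMassCubic.abs_mix3_le_mass` (the cubic pointwise shape) and `windowedMajorant_mix3_le` (its (Mκ) letter from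
the vertex mass letter (M)), `GhostMixTwoLeg.windowedMass_bond_le` ((M) for the bond-letter 0-form family, p253304), `GhostLoopCountingMix.ghostColumn_engineLetters`
(the (I-gh) sup letter of `kerH (N−1) a`) and F′ (p253277).  The `(c, e)` entry of the cubic ghost word: the direction-`c` averaging jet at `b` (bond-letter family),
the inner minimiser leg back to the root block, the scalar two-point leg `Γ` from the jet's field point, and the direction-`e` background jet `Ḣ^{(e)}_{b′}` of the
scalar covariant Laplacian at the bond `(b′, e)` — `Γ` and `Ḣ` ABSTRACT with DISPLAYED letters ((Γ₀)(Γ₁) at the window rate, (H)(H0) per direction), exactly as in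
the one-leg END `GhostLoopCountingMixCubic.ghost_mix3_rem`.  It asserts nothing about Bałaban's constrained objects, cites nothing, mints no `Prop` fact, has no
`def`, 0 sorry.  NOT α2-c PART 2, NOT the instances of `Γ`∕`Ḣ` ((LEDGER-gh)), NOT hsplit, NOT D1, NOT BetaPertH, NOT continuum, NOT Clay.

ABSOLUTE RULE (cell charter, verbatim): «No internally-minted statement may enter as a cited fact. Every hypothesis is either kernel-proved in this
package or a verbatim quotation of a PUBLISHED theorem with page reference. The manuscript(s) under audit are NOT citable for their own disputed
steps — they are the thing under adjudication; programme-internal (2001/route/tribunal) claims are never citable.»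

CONTENT ([our object] plumbing): §1 **`ghost_mix3_twoLeg`** (∃ a majorant `κ` with (κ) ∧ (Mκ), the (Mκ) bound DISPLAYED with its explicit `N¹` — the cubic leg's zeroth
fine moment, as in the one-leg engine); §2 **`ghost_mix3_secondMoment_twoLeg`** (F′'s core BY NAME at the pair, ANY two outer legs with (J)(J′)).
Provenance: D1 formalisation swarm LEAF PROVER 05, unit `b2b-balaban-beta-d1-formalise-leaf-05` gen 15, 2026-08-21, road FP row KER-γ (α2) sub-row α2-c (owner GO
R-FP-35 (a), words l.28227 ∕ l.28436; R-FP-36 (b)); «not in print; our bookkeeping»; no existing file touched.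
-/

noncomputable section

namespace Summit.QuantumFields.BalabanUV.Beta.FP.GhostMixCubicTwoLeg

open Finset Real
open scoped BigOperators
open Literature.MathematicalPhysics.QuantumFieldTheory.Balaban1983to89
open Literature.MathematicalPhysics.QuantumFieldTheory.Balaban1983to89.Beta
open B12Sec2to5 (l1)
open ExpKernelCalculus (Zl Zl_pos)
open DyadicShell (Pt supNorm)
open AxialBlockWeights (fineBlock)
open B5Hk103ScalarZd (kerH deltaH deltaH_pos)
open Summit.QuantumFields.BalabanUV.Beta.FP.AveragingJetLettersRooted (ker₁)
open Summit.QuantumFields.BalabanUV.Beta.FP.ScalarAveragingJetLetters (sclW sclFld sclBg)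
open Summit.QuantumFields.BalabanUV.Beta.FP.MixLoopPowerCountingMassCubic (abs_mix3_le_mass windowedMajorant_mix3_le)
open Summit.QuantumFields.BalabanUV.Beta.FP.GhostLoopCountingMix (ghostColumn_engineLetters)
open Summit.QuantumFields.BalabanUV.Beta.FP.GhostMixTwoLeg (windowedMass_bond_le)
open Summit.QuantumFields.BalabanUV.Beta.FP.FineSplitJunctionMajorant (coarse_secondMoment_abs_of_majorant_twoLeg)

/-! ## §1 The ghost (MIX-3) word: a majorant with its windowed letter -/

section Ghost

/-- **`ghost_mix3_twoLeg` — THE GHOST (MIX-3) WORD IN THE TWO-LEG MAJORANT CURRENCY** ([our object]).  With the (I-gh) sup constant `Cg` of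
`ghostColumn_engineLetters`: for every window rate `δ > 0`, jet rate `δ_H > 0`, `a > 0`, `N ≥ 1`, every 0-form rooted block family with BOND letters (`p ≥ 0`, word
length `≤ ℓ₀`, letters within `R₀N` of the root block), ANY coarse windows `U b`, finite offsets with (W) `‖w‖∞ ≤ (R₀+1)N`, an ABSTRACT scalar two-point leg `Γ` with
(Γ₀) `|Γ c x| ≤ C_Γ`, (Γ₁) `|Γ c (t+e_i) − Γ c t| ≤ C_Γ′(‖c−t‖∞+1)⁻³e^{−(δ∕N)‖c−t‖∞}` and an ABSTRACT direction-indexed background jet `Ḣ : Fin 4 → Pt → Pt → Pt → ℝ` with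
(H) `|Ḣ e b′ x x′| ≤ C_H·e^{−δ_H|x−b′|₁}e^{−δ_H|x′−b′|₁}`, (H0) `Σ'_x Ḣ e b′ x x′ = 0`: THERE IS a majorant `κ c e b b′` of the `(c, e)` entry
`k₃^{gh,(c,e)}(b,b′) = Σ_{u∈U b}Σ_{w∈W} ker₁^{(u)} (b,c) (b+w)·Σ'_{x′} kerH(N−1) a x′ u·Σ'_x Γ (b+w) x·Ḣ e b′ x x′` (`abs_mix3_le_mass` BY NAME) whose windowed majorant
letter (Mκ) at every coarse centre `v₀` and every fine window `S` is `≤ (Cg·(C_H·Zl 4 δ_H))·Ψ·A_M` with the cubic engine's `Ψ` (explicit `N¹`, radius multiplier `R₀+1`)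
and `A_M = (ℓ₀·Σp)·e^{δR₀∕2}·(e^{δ∕2}(1+480e^{δ∕4}(4∕δ)⁴))` (`windowedMajorant_mix3_le` with (M) := `windowedMass_bond_le` BY NAME) — the (hk)(Mκ) binders of F′. -/
theorem ghost_mix3_twoLeg :
    ∃ Cg : ℝ, 0 ≤ Cg ∧ ∀ δ δH : ℝ, 0 < δ → 0 < δH → ∀ {a : ℝ}, 0 < a → ∀ (N : ℕ), 1 ≤ N →
      ∀ {σ : Type*} [Fintype σ] {p : σ → ℝ} (_ : ∀ s, 0 ≤ p s)
        {rad : σ → Pt → Pt → List (Pt × Fin 4)} {ℓ₀ R₀ : ℕ} (_ : ∀ s u x', (rad s u x').length ≤ ℓ₀)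
        (_ : ∀ (s : σ) (u : Pt) (x : ↥(fineBlock N)) (ℓ : Pt × Fin 4), ℓ ∈ rad s u x.1 → supNorm (ℓ.1 - (N : ℤ) • u) ≤ R₀ * N)
        (U : Pt → Finset Pt) {W : Finset Pt} (_ : ∀ w ∈ W, supNorm w ≤ (R₀ + 1) * N)
        {Γ : Pt → Pt → ℝ} {H : Fin 4 → Pt → Pt → Pt → ℝ} {C_Γ C_Γ' C_H : ℝ}
        (_ : ∀ c x, |Γ c x| ≤ C_Γ)
        (_ : ∀ c t (i : Fin 4), |Γ c (t + Pi.single i 1) - Γ c t|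
          ≤ C_Γ' / ((supNorm (c - t) : ℝ) + 1) ^ 3 * Real.exp (-(δ / N) * (supNorm (c - t) : ℝ)))
        (_ : ∀ e b' x x', |H e b' x x'| ≤ C_H * Real.exp (-δH * l1 (x - b')) * Real.exp (-δH * l1 (x' - b')))
        (_ : ∀ e b' x', ∑' x, H e b' x x' = 0),
        ∃ κ : Fin 4 → Fin 4 → Pt → Pt → ℝ,
          (∀ (c e : Fin 4) (b b' : Pt),
            |∑ u ∈ U b, ∑ w ∈ W, ker₁ (sclW N p) (sclFld N u) (sclBg N u rad) (b, c) (b + w) *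
                ∑' x', kerH (N - 1) a x' u * ∑' x, Γ (b + w) x * H e b' x x'| ≤ κ c e b b') ∧
          (∀ (c e : Fin 4) (v₀ : Pt) (S : Finset Pt),
            ∑ b ∈ S, ∑ b' ∈ S, Real.exp (-(δ / (2 * N)) * (supNorm (b - (N : ℤ) • v₀) : ℝ)) *
                (1 + ((supNorm (b' - b) : ℝ) / N) ^ 2) * κ c e b b'
              ≤ (Cg * (C_H * Zl 4 δH)) *
                  ((256 / 27 * C_Γ' * (Real.exp (δH / 2) * (2 / δH) * Zl 4 (δH / 2)))
                      * ((1 + 2 * ((R₀ : ℝ) + 1) ^ 2) * (1 + 80 * Real.exp ((3 * δ / 4) / 2) * (2 / (3 * δ / 4)))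
                        + 2 * (1 + 160 * Real.exp ((3 * δ / 4) / 2) * (2 / (3 * δ / 4)) ^ 3)) * N
                    + (2 * C_Γ * 20 ^ 8 * (40320 * Real.exp (δH / 2) * (2 / δH) ^ 8 * Zl 4 (δH / 2))
                        + (8 * C_Γ * (Real.exp (δH / 2) * (2 / δH) * Zl 4 (δH / 2)) + 2 * C_Γ * (Real.exp (δH / 2) * Zl 4 (δH / 2))) * 5 ^ 8)
                      * 81 * (3 + 2 * ((R₀ : ℝ) + 1) ^ 2)) *
                  ((((ℓ₀ : ℕ) : ℝ) * ∑ s, p s) * Real.exp (δ * R₀ / 2) *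
                    (Real.exp (δ / 2) * (1 + 480 * Real.exp (δ / 4) * (4 / δ) ^ 4)))) := by
  obtain ⟨C, C', hC, _, h⟩ := ghostColumn_engineLetters
  refine ⟨C, hC, fun δ δH hδ hδH a ha N hN σ _ p hp rad ℓ₀ R₀ hrad hradR U W hW Γ H C_Γ C_Γ' C_H hΓ0 hΓ1 hH hH0 => ?_⟩
  obtain ⟨hI, _⟩ := h ha N hN
  -- the sup letter of the inner leg
  have hI0 : ∀ x u : Pt, |kerH (N - 1) a x u| ≤ C := by
    intro x u
    refine (hI x u).trans ?_
    have h1 : Real.exp (-(deltaH 4 1 / N) * (supNorm (x - (N : ℤ) • u) : ℝ)) ≤ 1 := by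
      apply Real.exp_le_one_iff.mpr
      have hδ1 : 0 < deltaH 4 1 := deltaH_pos 4 one_pos
      have hN' : (0 : ℝ) < N := by exact_mod_cast hN
      have : (0 : ℝ) ≤ (supNorm (x - (N : ℤ) • u) : ℝ) := Nat.cast_nonneg _
      have : 0 ≤ deltaH 4 1 / N * (supNorm (x - (N : ℤ) • u) : ℝ) := by positivity
      linarith
    calc C * Real.exp (-(deltaH 4 1 / N) * (supNorm (x - (N : ℤ) • u) : ℝ)) ≤ C * 1 := mul_le_mul_of_nonneg_left h1 hC
      _ = C := mul_one C
  -- nonnegativity of the cubic constants (as in `coarse_mix3_secondMoment_le`)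
  have hCΓ : 0 ≤ C_Γ := (abs_nonneg _).trans (hΓ0 0 0)
  have hCΓ' : 0 ≤ C_Γ' := by
    have h := hΓ1 0 0 0
    rw [sub_self, show supNorm (0 : Pt) = 0 from DyadicShell.supNorm_eq_zero_iff.mpr rfl] at h
    norm_num at h
    exact (abs_nonneg _).trans h
  have hCH : 0 ≤ C_H := by
    have h := hH 0 0 0 0
    rw [sub_self, show l1 (0 : Pt) = 0 by unfold l1; simp, mul_zero, Real.exp_zero, mul_one, mul_one] at h
    exact (abs_nonneg _).trans h
  have hZ : 0 < Zl 4 δH := Zl_pos hδH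
  have hZ2 : 0 < Zl 4 (δH / 2) := Zl_pos (half_pos hδH)
  have hK₁ : 0 ≤ 256 / 27 * C_Γ' * (Real.exp (δH / 2) * (2 / δH) * Zl 4 (δH / 2)) := by positivity
  have hK₂ : 0 ≤ 2 * C_Γ * 20 ^ 8 * (40320 * Real.exp (δH / 2) * (2 / δH) ^ 8 * Zl 4 (δH / 2))
      + (8 * C_Γ * (Real.exp (δH / 2) * (2 / δH) * Zl 4 (δH / 2)) + 2 * C_Γ * (Real.exp (δH / 2) * Zl 4 (δH / 2))) * 5 ^ 8 := by
    positivity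
  have hL : 0 ≤ C * (C_H * Zl 4 δH) := by positivity
  refine ⟨fun c e b b' => ∑ u ∈ U b, ∑ w ∈ W, |ker₁ (sclW N p) (sclFld N u) (sclBg N u rad) (b, c) (b + w)| * (C * (C_H * Zl 4 δH) *
      ((256 / 27 * C_Γ' * (Real.exp (δH / 2) * (2 / δH) * Zl 4 (δH / 2)))
          * (Real.exp (-(3 * δ / 4 / N) * (supNorm (b + w - b') : ℝ)) / ((supNorm (b + w - b') : ℝ) + 1) ^ 3)
        + (2 * C_Γ * 20 ^ 8 * (40320 * Real.exp (δH / 2) * (2 / δH) ^ 8 * Zl 4 (δH / 2))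
            + (8 * C_Γ * (Real.exp (δH / 2) * (2 / δH) * Zl 4 (δH / 2)) + 2 * C_Γ * (Real.exp (δH / 2) * Zl 4 (δH / 2))) * 5 ^ 8)
          / ((supNorm (b + w - b') : ℝ) + 1) ^ 8)), fun c e b b' => ?_, fun c e v₀ S => ?_⟩
  · exact abs_mix3_le_mass (U := U) (W := W) (qd := fun u b x => ker₁ (sclW N p) (sclFld N u) (sclBg N u rad) (b, c) x)
      (I := fun x' u => kerH (N - 1) a x' u) (Γ := Γ) (H := H e) hδ hδH hN hI0 hΓ0 hΓ1 (hH e) (hH0 e) b b'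
  · have hM := windowedMass_bond_le hδ hN hp hrad hradR U W S c ((N : ℤ) • v₀)
    have hmaj := windowedMajorant_mix3_le (qd := fun u b x => ker₁ (sclW N p) (sclFld N u) (sclBg N u rad) (b, c) x)
      (U := U) (W := W) (n := N) (R := R₀ + 1) hδ hN hK₁ hK₂ hL hW S v₀ hM
    have e1 : (((R₀ + 1 : ℕ) : ℝ)) = (R₀ : ℝ) + 1 := by push_cast; ring
    rw [e1] at hmaj
    exact hmaj

/-! ## §2 The by-name junction check: the pair IS the input of F′'s two-leg majorant core, for ANY two outer legs -/

/-- **`ghost_mix3_secondMoment_twoLeg` — THE GHOST (MIX-3) WORD THROUGH F′'s TWO-LEG MAJORANT CORE** ([our object];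
`FineSplitJunctionMajorant.coarse_secondMoment_abs_of_majorant_twoLeg` BY NAME at §1's majorant): with `Cg` of `ghost_mix3_twoLeg`, for every `δ, δ_H > 0`, `a > 0`,
`N ≥ 1`, family, windows and abstract legs as there, every `(c, e)`, ANY reference leg `J₁` with (J) at rate `δ∕N`, anchor `v₀`, and running leg `J₂` with (J′), all
finite `S`, `V`: `Σ_{v∈V}‖v−v₀‖∞²·Σ_{b,b′∈S}|J₁ b|·|J₂ b′ v|·|k₃^{gh,(c,e)}(b,b′)| ≤ 3·C_J·C_J′·(1+16∕δ²)·((Cg·(C_H·Zl 4 δ_H))·Ψ·A_M)` — the one-leg END's number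
(`GhostLoopCountingMixCubic.coarse_mix3_secondMoment_scl`) in the junction's currency. -/
theorem ghost_mix3_secondMoment_twoLeg :
    ∃ Cg : ℝ, 0 ≤ Cg ∧ ∀ δ δH : ℝ, 0 < δ → 0 < δH → ∀ {a : ℝ}, 0 < a → ∀ (N : ℕ), 1 ≤ N →
      ∀ {σ : Type*} [Fintype σ] {p : σ → ℝ} (_ : ∀ s, 0 ≤ p s)
        {rad : σ → Pt → Pt → List (Pt × Fin 4)} {ℓ₀ R₀ : ℕ} (_ : ∀ s u x', (rad s u x').length ≤ ℓ₀)
        (_ : ∀ (s : σ) (u : Pt) (x : ↥(fineBlock N)) (ℓ : Pt × Fin 4), ℓ ∈ rad s u x.1 → supNorm (ℓ.1 - (N : ℤ) • u) ≤ R₀ * N)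
        (U : Pt → Finset Pt) {W : Finset Pt} (_ : ∀ w ∈ W, supNorm w ≤ (R₀ + 1) * N)
        {Γ : Pt → Pt → ℝ} {H : Fin 4 → Pt → Pt → Pt → ℝ} {C_Γ C_Γ' C_H : ℝ}
        (_ : ∀ c x, |Γ c x| ≤ C_Γ)
        (_ : ∀ c t (i : Fin 4), |Γ c (t + Pi.single i 1) - Γ c t|
          ≤ C_Γ' / ((supNorm (c - t) : ℝ) + 1) ^ 3 * Real.exp (-(δ / N) * (supNorm (c - t) : ℝ)))
        (_ : ∀ e b' x x', |H e b' x x'| ≤ C_H * Real.exp (-δH * l1 (x - b')) * Real.exp (-δH * l1 (x' - b')))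
        (_ : ∀ e b' x', ∑' x, H e b' x x' = 0) (c e : Fin 4)
        {J₁ : Pt → ℝ} {J₂ : Pt → Pt → ℝ} {C_J C_J' : ℝ} (S V : Finset Pt) (v₀ : Pt)
        (_ : ∀ b, |J₁ b| ≤ C_J * Real.exp (-(δ / N) * (supNorm (b - (N : ℤ) • v₀) : ℝ)))
        (_ : ∀ b', ∑ v ∈ V, (1 + ((supNorm (b' - (N : ℤ) • v) : ℝ) / N) ^ 2) * |J₂ b' v| ≤ C_J'),
        ∑ v ∈ V, (supNorm (v - v₀) : ℝ) ^ 2 * ∑ b ∈ S, ∑ b' ∈ S, |J₁ b| * |J₂ b' v| *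
            |∑ u ∈ U b, ∑ w ∈ W, ker₁ (sclW N p) (sclFld N u) (sclBg N u rad) (b, c) (b + w) *
                ∑' x', kerH (N - 1) a x' u * ∑' x, Γ (b + w) x * H e b' x x'|
          ≤ 3 * C_J * C_J' * (1 + 16 / δ ^ 2) *
              ((Cg * (C_H * Zl 4 δH)) *
                  ((256 / 27 * C_Γ' * (Real.exp (δH / 2) * (2 / δH) * Zl 4 (δH / 2)))
                      * ((1 + 2 * ((R₀ : ℝ) + 1) ^ 2) * (1 + 80 * Real.exp ((3 * δ / 4) / 2) * (2 / (3 * δ / 4)))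
                        + 2 * (1 + 160 * Real.exp ((3 * δ / 4) / 2) * (2 / (3 * δ / 4)) ^ 3)) * N
                    + (2 * C_Γ * 20 ^ 8 * (40320 * Real.exp (δH / 2) * (2 / δH) ^ 8 * Zl 4 (δH / 2))
                        + (8 * C_Γ * (Real.exp (δH / 2) * (2 / δH) * Zl 4 (δH / 2)) + 2 * C_Γ * (Real.exp (δH / 2) * Zl 4 (δH / 2))) * 5 ^ 8)
                      * 81 * (3 + 2 * ((R₀ : ℝ) + 1) ^ 2)) *
                  ((((ℓ₀ : ℕ) : ℝ) * ∑ s, p s) * Real.exp (δ * R₀ / 2) *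
                    (Real.exp (δ / 2) * (1 + 480 * Real.exp (δ / 4) * (4 / δ) ^ 4)))) := by
  obtain ⟨Cg, hCg, h⟩ := ghost_mix3_twoLeg
  refine ⟨Cg, hCg, fun δ δH hδ hδH a ha N hN σ _ p hp rad ℓ₀ R₀ hrad hradR U W hW Γ H C_Γ C_Γ' C_H hΓ0 hΓ1 hH hH0 c e
    J₁ J₂ C_J C_J' S V v₀ hJ hJ' => ?_⟩
  obtain ⟨κ, hk, hM⟩ := h δ δH hδ hδH ha N hN hp hrad hradR U hW hΓ0 hΓ1 hH hH0
  exact coarse_secondMoment_abs_of_majorant_twoLeg (n := N) (S := S) (V := V) (v₀ := v₀) (J₁ := J₁) (J₂ := J₂)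
    (κ := κ c e) hδ hN (fun b b' => hk c e b b') hJ hJ' (hM c e v₀ S)

end Ghost

end Summit.QuantumFields.BalabanUV.Beta.FP.GhostMixCubicTwoLeg

end
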